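import Literature.Combinatorics.AssociationSchemes.CutMatchingRestriction
import Literature.Combinatorics.SetFamily.SpreadApproximationWeighted
import HarnessLib

/-!
# Restricting a STRATEGY — a function of the pair (cut, perfect matching) — to the reduced instance:
# pair-level sum transport, lifted cuts and matchings, psd rectangles on non-crossing cells, and
# weighted (trace-density) homogeneity of a reduced Kupavskii–Zakharov piece

Cell pnp-psdrank (summit PneNP, rung F-N2, route `ChebyshevTracialDesign`, crux stmt-PneNP-19878 `TracialDecayExp20`).
`CutMatchingRestriction.lean` transports CELL SUMS of level functions `F(|U|, |δ(U) ∩ M|)` to the reduced instance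
`K_m`, `m = n − |V|` — enough for the `r = 1` rung, whose strategies are rectangles `A × B` and whose cell values are
functions of the level data alone. A psd strategy of the crux is a pair of matrix-valued functions
`X : OddSet n → M_r(ℝ)`, `Y : PMatch n → M_r(ℝ)` (`0 ⪯ X_U, Y_M ⪯ I`, `X_U Y_M = 0` on the tight pairs, tree: `IsPsdRect`),
and its cell sums have summands `W(U,M) · tr(X_U Y_M)` that depend on the PAIR. This file is the corresponding
bookkeeping, asked for by the cell's psd programme (prover MEMO-13 §3 (3): «weighted Kupavskii–Zakharov with
`y(M) = tr(Y_M)/r` — the S1 step of a psd rung»; planner N2-SpreadStructure §SNT (4): directional/weighted cells):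

* §1 the pair-level SUM TRANSPORT `sum_cell_eq_sum_pullback_pair`: for ANY summand `g(U, M)` with values in an additive
  commutative monoid (e.g. `M_r(ℝ)` or `ℝ`), `Σ_{U ∈ X, U ∩ V = π} Σ_{M ∈ Y, M ⊇ S} g(U, M) = Σ_{Ũ} Σ_{M̃} g(emb(Ũ) ∪ π, S ∪ emb(M̃))`
  over the pulled-back families, where `Ũ ↦ emb(Ũ) ∪ π` and `M̃ ↦ S ∪ emb(M̃)` are the LIFTS inverse to
  `cutPullback` / `pmPullback` on the cell; crossing counts of lifted pairs (`crossCount_lift`: `cc = c̃c + y`,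
  `y = crossCount π S`);
* §2 the same in the kernel's currency: `liftOdd : OddSet m → OddSet n` (even pattern `π ⊆ V`),
  `liftPMatch : PMatch m → PMatch n` (core `S`, a perfect matching of `V`), `cc (liftOdd Ũ) (liftPMatch M̃) = cc Ũ M̃ + y`,
  injectivity, and the transport `sum_cell_eq_sum_lift` over `oddCellCuts × pmCellMatchings` for `g : OddSet n → PMatch n → β`;
* §3 REDUCED STRATEGIES `X ∘ liftOdd`, `Y ∘ liftPMatch`: on a NON-CROSSING cell (`y = 0`) a psd rectangle of dimension `r`
  restricts to a psd rectangle of dimension `r` of the reduced instance (`IsPsdRect.lift` — the psd analogue of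
  "tight-free rectangles restrict to tight-free rectangles"); for every cell the psd/contraction conditions transport
  (`isContractionFamily_lift`); and the cell value `Σ W(U,M) · tr(X_U Y_M)` of a planted weight `W = levelWeight n t C w` is the
  value of the reduced strategy against the SHIFTED level function (`cell_value_eq_lift`);
* §4 WEIGHTED HOMOGENEITY TRANSPORTS (the weighted companions of `isRelHomogeneous_cellMatchings(_piece)`): for a weight
  `y` on edge sets of `K_n` and the REDUCED WEIGHT `M̃ ↦ y(S ∪ emb(M̃))`, `(PM_n(S), τ)`-homogeneity of `y|_ℱ` — e.g. a piece of
  `SpreadApproximationWeighted.exists_weightedSpreadApproximation` — is `(PM_m, τ)`-homogeneity of the reduced weight on the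
  pulled-back family, with the same mass (`wmass_cellMatchings`, `isRelHomogeneousW_cellMatchings`,
  `isRelHomogeneousW_cellMatchings_piece`, `isRelHomogeneousW_pmCellMatchings_piece`), and the reduced weight of a
  weight coming from `PMatch n` is that weight at the lifted matching (`dite_weight_lift`).

References: Rothvoß 2017 §2 [Rothvoss2017] (cuts, `|δ(U) ∩ M|`, the planted weights); Kupavskii–Zakharov 2022 §2 and
Lemma 11 [KupavskiiZakharov2022] (links, homogeneity, invariance under renaming the ground set); Briët–Dadush–Pokutta
[BrietDadushPokutta2014, Thm. 6 (§3)] (psd rectangles = normalised psd factorizations). Everything is elementary double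
counting [folklore]; no named fact is introduced. WHAT THIS IS NOT: no estimate (none of S3/S4 of a psd rung), nothing on
`TracialDecayExp20` itself, nothing about psd rank, no P-vs-NP content. Label: instrument (Literature glue).
-/

noncomputable section

namespace Literature.Combinatorics.AssociationSchemes.CutMatchingRestrictionStrategies

open Finset Matrix
open Literature.Barriers.PneNP
open Literature.Combinatorics.SetFamily
open Literature.Combinatorics.SimpleGraph.CycleSpace
open Literature.Combinatorics.AssociationSchemes.HomogeneousMatchingFamilies
open Literature.Combinatorics.AssociationSchemes.CutMatchingRestriction
open Literature.Combinatorics.Optimization (levelWeight IsPsdRect)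

variable {n m : ℕ}

/-! ## §1 Pair-level sum transport and lifted pairs (vertex sets and edge sets) -/

section PairTransport

/-- **SUM TRANSPORT FOR PAIR FUNCTIONS.** For a perfect matching `S` of `V ⊆ Fin n`, a pattern `π`, a family `X` of vertex
sets, a family `Y` of perfect matchings of `K_n` and ANY summand `g(U, M)` with values in an additive commutative monoid:
`Σ_{U ∈ X, U ∩ V = π} Σ_{M ∈ Y, S ⊆ M} g(U, M) = Σ_{Ũ ∈ X̃} Σ_{M̃ ∈ Ỹ} g(emb(Ũ) ∪ π, S ∪ emb(M̃))` over the pulled-back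
families `X̃ = cellCuts X V π h`, `Ỹ = cellMatchings Y V S h` in `K_m`, `m = n − |V|` (the lifts invert the pull-backs on the
cell: `emb(Ũ) ∪ π = (U ∖ V) ∪ (U ∩ V) = U`, `S ∪ emb(M̃) = S ∪ (M ∖ S) = M`).
[cite: Rothvoss2017, §2 (PDF p. 6)] [cite: KupavskiiZakharov2022, §2 (p. 6, the link; renaming the ground set)] -/
theorem sum_cell_eq_sum_pullback_pair {β : Type*} [AddCommMonoid β] {V π : Finset (Fin n)}
    {S : Finset (Sym2 (Fin n))} (hS : IsPMOn V S) (h : (univ \ V).card = m) (X : Finset (Finset (Fin n)))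
    {Y : Finset (Finset (Sym2 (Fin n)))} (hY : Y ⊆ perfectMatchings univ)
    (g : Finset (Fin n) → Finset (Sym2 (Fin n)) → β) :
    ∑ U ∈ cutsWith X V π, ∑ M ∈ supersets Y S, g U M =
      ∑ Ut ∈ cellCuts X V π h, ∑ Mt ∈ cellMatchings Y V S h,
        g (Ut.image (emb V h) ∪ π) (S ∪ Mt.image (Sym2.map (emb V h))) := by
  rw [cellCuts, sum_image fun U₁ h₁ U₂ h₂ heq =>
    cutPullback_injOn h (mem_cutsWith.1 h₁).2 (mem_cutsWith.1 h₂).2 heq]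
  refine sum_congr rfl fun U hU => ?_
  obtain ⟨-, hUV⟩ := mem_cutsWith.1 hU
  have hpm : ∀ M ∈ supersets Y S, IsPMOn univ M := fun M hM =>
    mem_perfectMatchings.1 (hY (mem_supersets.1 hM).1)
  rw [cellMatchings, sum_image fun M₁ h₁ M₂ h₂ heq =>
    pmPullback_injOn h hS (hpm M₁ h₁) (hpm M₂ h₂) (mem_supersets.1 h₁).2 (mem_supersets.1 h₂).2 heq]
  refine sum_congr rfl fun M hM => ?_
  rw [image_cutPullback, image_pmPullback_eq_sdiff h hS (hpm M hM) (mem_supersets.1 hM).2,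
    union_sdiff_of_subset (mem_supersets.1 hM).2, ← hUV, sdiff_union_inter]

/-- **Crossing count of a lifted pair**: `|δ(emb(Ũ) ∪ π) ∩ (S ∪ emb(M̃))| = |δ(Ũ) ∩ M̃| + y`, `y = crossCount π S` the number of
core edges crossing the pattern (`π ⊆ V`, `M̃` a perfect matching of `K_m`). [cite: Rothvoss2017, §2 (PDF pp. 5–6)] -/
theorem crossCount_lift {V π : Finset (Fin n)} {S : Finset (Sym2 (Fin n))} (hS : IsPMOn V S) (hπ : π ⊆ V)
    (h : (univ \ V).card = m) (Ut : Finset (Fin m)) {Mt : Finset (Sym2 (Fin m))} (hMt : IsPMOn univ Mt) :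
    crossCount (Ut.image (emb V h) ∪ π) (S ∪ Mt.image (Sym2.map (emb V h))) = crossCount Ut Mt + crossCount π S := by
  obtain ⟨hM, hSM⟩ := isPMOn_union_image h hS hMt
  rw [crossCount_eq_crossCount_pullback_add h hS hM hSM, cutPullback_image_union h hπ,
    pmPullback_union_image V h hS.subset_sym2, image_union_inter h hπ]

/-- The lifted matching is a perfect matching of `K_n` containing the core. [cite: KupavskiiZakharov2022, §2 (p. 6: `𝒜(S)` for perfect matchings)] -/
theorem isPMOn_lift {V : Finset (Fin n)} {S : Finset (Sym2 (Fin n))} (hS : IsPMOn V S) (h : (univ \ V).card = m)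
    {Mt : Finset (Sym2 (Fin m))} (hMt : IsPMOn univ Mt) :
    IsPMOn univ (S ∪ Mt.image (Sym2.map (emb V h))) :=
  (isPMOn_union_image h hS hMt).1

/-- The lifted cut has the prescribed pattern: `(emb(Ũ) ∪ π) ∩ V = π`. [cite: Rothvoss2017, §2 (PDF p. 6)] -/
theorem lift_inter {V π : Finset (Fin n)} (h : (univ \ V).card = m) (hπ : π ⊆ V) (Ut : Finset (Fin m)) :
    (Ut.image (emb V h) ∪ π) ∩ V = π :=
  image_union_inter h hπ Ut

/-- The lifted cut has `|Ũ| + |π|` elements. [cite: Rothvoss2017, §2 (PDF p. 6)] -/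
theorem card_lift {V π : Finset (Fin n)} (h : (univ \ V).card = m) (hπ : π ⊆ V) (Ut : Finset (Fin m)) :
    (Ut.image (emb V h) ∪ π).card = Ut.card + π.card :=
  card_image_union h hπ Ut

end PairTransport

/-! ## §2 The kernel's currency: `liftOdd`, `liftPMatch`, and the transport over `oddCellCuts × pmCellMatchings` -/

section Kernel

/-- **Lift of a reduced odd cut**: `Ũ ↦ emb(Ũ) ∪ π` as a map `OddSet m → OddSet n` (the pattern `π ⊆ V` has even size, so
`|emb(Ũ) ∪ π| = |Ũ| + |π|` stays odd). Inverse to `cutPullback` on the pattern class `U ∩ V = π`.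
[cite: Rothvoss2017, §2 (PDF p. 6)] -/
def liftOdd (V π : Finset (Fin n)) (h : (univ \ V).card = m) (hπ : π ⊆ V) (hπe : Even π.card) (Ut : OddSet m) :
    OddSet n :=
  ⟨Ut.1.image (emb V h) ∪ π, by rw [card_image_union h hπ]; exact Ut.2.add_even hπe⟩

/-- **Lift of a reduced perfect matching**: `M̃ ↦ S ∪ emb(M̃)` as a map `PMatch m → PMatch n` (`S` a perfect matching of
`V`). Inverse to `pmPullback` on the star of `S`. [cite: KupavskiiZakharov2022, §2 (p. 6: `𝒜(S)` and the link)] -/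
def liftPMatch (V : Finset (Fin n)) (S : Finset (Sym2 (Fin n))) (h : (univ \ V).card = m) (hS : IsPMOn V S)
    (Mt : PMatch m) : PMatch n :=
  ⟨S ∪ Mt.1.image (Sym2.map (emb V h)), isPMOn_lift hS h Mt.2⟩

/-- The underlying vertex set of a lifted cut. [cite: Rothvoss2017, §2 (PDF p. 6)] -/
@[simp] theorem liftOdd_val {V π : Finset (Fin n)} (h : (univ \ V).card = m) (hπ : π ⊆ V) (hπe : Even π.card)
    (Ut : OddSet m) : (liftOdd V π h hπ hπe Ut).1 = Ut.1.image (emb V h) ∪ π := rfl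

/-- The underlying edge set of a lifted matching. [cite: KupavskiiZakharov2022, §2 (p. 6)] -/
@[simp] theorem liftPMatch_val {V : Finset (Fin n)} {S : Finset (Sym2 (Fin n))} (h : (univ \ V).card = m)
    (hS : IsPMOn V S) (Mt : PMatch m) : (liftPMatch V S h hS Mt).1 = S ∪ Mt.1.image (Sym2.map (emb V h)) := rfl

/-- A lifted matching contains the core. [cite: KupavskiiZakharov2022, §2 (p. 6)] -/
theorem core_subset_liftPMatch {V : Finset (Fin n)} {S : Finset (Sym2 (Fin n))} (h : (univ \ V).card = m)
    (hS : IsPMOn V S) (Mt : PMatch m) : S ⊆ (liftPMatch V S h hS Mt).1 :=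
  subset_union_left

/-- A lifted cut has pattern `π`. [cite: Rothvoss2017, §2 (PDF p. 6)] -/
theorem liftOdd_inter {V π : Finset (Fin n)} (h : (univ \ V).card = m) (hπ : π ⊆ V) (hπe : Even π.card)
    (Ut : OddSet m) : (liftOdd V π h hπ hπe Ut).1 ∩ V = π :=
  image_union_inter h hπ Ut.1

/-- `|liftOdd Ũ| = |Ũ| + |π|`. [cite: Rothvoss2017, §2 (PDF p. 6)] -/
theorem card_liftOdd {V π : Finset (Fin n)} (h : (univ \ V).card = m) (hπ : π ⊆ V) (hπe : Even π.card)
    (Ut : OddSet m) : (liftOdd V π h hπ hπe Ut).1.card = Ut.1.card + π.card :=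
  card_image_union h hπ Ut.1

/-- `cutPullback ∘ liftOdd = id`. [cite: Rothvoss2017, §2 (PDF p. 6)] -/
theorem cutPullback_liftOdd {V π : Finset (Fin n)} (h : (univ \ V).card = m) (hπ : π ⊆ V) (hπe : Even π.card)
    (Ut : OddSet m) : cutPullback V h (liftOdd V π h hπ hπe Ut).1 = Ut.1 :=
  cutPullback_image_union h hπ Ut.1

/-- `pmPullback ∘ liftPMatch = id`. [cite: KupavskiiZakharov2022, §2 (p. 6)] -/
theorem pmPullback_liftPMatch {V : Finset (Fin n)} {S : Finset (Sym2 (Fin n))} (h : (univ \ V).card = m)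
    (hS : IsPMOn V S) (Mt : PMatch m) : pmPullback V h (liftPMatch V S h hS Mt).1 = Mt.1 :=
  pmPullback_union_image V h hS.subset_sym2 Mt.1

/-- `liftOdd` is injective. [cite: Rothvoss2017, §2 (PDF p. 6)] -/
theorem liftOdd_injective {V π : Finset (Fin n)} (h : (univ \ V).card = m) (hπ : π ⊆ V) (hπe : Even π.card) :
    Function.Injective (liftOdd V π h hπ hπe) := fun U₁ U₂ heq => by
  apply Subtype.ext
  rw [← cutPullback_liftOdd h hπ hπe U₁, ← cutPullback_liftOdd h hπ hπe U₂, heq]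

/-- `liftPMatch` is injective. [cite: KupavskiiZakharov2022, §2 (p. 6)] -/
theorem liftPMatch_injective {V : Finset (Fin n)} {S : Finset (Sym2 (Fin n))} (h : (univ \ V).card = m)
    (hS : IsPMOn V S) : Function.Injective (liftPMatch V S h hS) := fun M₁ M₂ heq => by
  apply Subtype.ext
  rw [← pmPullback_liftPMatch h hS M₁, ← pmPullback_liftPMatch h hS M₂, heq]

/-- **Crossing count of a lifted pair**, kernel currency: `cc (liftOdd Ũ) (liftPMatch M̃) = cc Ũ M̃ + y`, `y = crossCount π S`.
In particular on a non-crossing cell (`y = 0`) the lift preserves `cc`, hence tightness. [cite: Rothvoss2017, §2 (PDF pp. 5–6)] -/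
theorem cc_lift {V π : Finset (Fin n)} {S : Finset (Sym2 (Fin n))} (hS : IsPMOn V S) (h : (univ \ V).card = m)
    (hπ : π ⊆ V) (hπe : Even π.card) (Ut : OddSet m) (Mt : PMatch m) :
    cc (liftOdd V π h hπ hπe Ut) (liftPMatch V S h hS Mt) = cc Ut Mt + crossCount π S := by
  rw [cc_eq_crossCount, cc_eq_crossCount]
  exact crossCount_lift hS hπ h Ut.1 Mt.2

/-- A lifted reduced cut of `X̃ = oddCellCuts X V π h` is a member of `X` with pattern `π`. [cite: Rothvoss2017, §2 (PDF p. 6)] -/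
theorem liftOdd_mem {V π : Finset (Fin n)} (h : (univ \ V).card = m) (hπ : π ⊆ V) (hπe : Even π.card)
    {X : Finset (OddSet n)} {Ut : OddSet m} (hUt : Ut ∈ oddCellCuts X V π h) :
    liftOdd V π h hπ hπe Ut ∈ X.filter fun U => U.1 ∩ V = π := by
  have hUt' : Ut.1 ∈ cellCuts (X.image Subtype.val) V π h := (mem_subtype.1 hUt)
  obtain ⟨U, hU, hUV, hUeq⟩ := mem_cellCuts.1 hUt'
  obtain ⟨U', hU'X, rfl⟩ := mem_image.1 hU
  have hval : (liftOdd V π h hπ hπe Ut).1 = U'.1 := by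
    rw [liftOdd_val, ← hUeq, image_cutPullback, ← hUV, sdiff_union_inter]
  rw [Subtype.ext hval]
  exact mem_filter.2 ⟨hU'X, hUV⟩

/-- A lifted reduced matching of `Ỹ = pmCellMatchings Y V S h` is a member of `Y` containing `S`.
[cite: KupavskiiZakharov2022, §2 (p. 6)] -/
theorem liftPMatch_mem {V : Finset (Fin n)} {S : Finset (Sym2 (Fin n))} (h : (univ \ V).card = m) (hS : IsPMOn V S)
    {Y : Finset (PMatch n)} {Mt : PMatch m} (hMt : Mt ∈ pmCellMatchings Y V S h) :
    liftPMatch V S h hS Mt ∈ Y.filter fun M => S ⊆ M.1 := by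
  have hMt' : Mt.1 ∈ cellMatchings (Y.image Subtype.val) V S h := (mem_subtype.1 hMt)
  obtain ⟨M, hM, hSM, hMeq⟩ := mem_cellMatchings.1 hMt'
  obtain ⟨M', hM'Y, rfl⟩ := mem_image.1 hM
  have hval : (liftPMatch V S h hS Mt).1 = M'.1 := by
    rw [liftPMatch_val, ← hMeq, image_pmPullback_eq_sdiff h hS M'.2 hSM, union_sdiff_of_subset hSM]
  rw [Subtype.ext hval]
  exact mem_filter.2 ⟨hM'Y, hSM⟩

/-- Extension of a pair function on the subtypes to all pairs of (vertex set, edge set), by zero. [folklore] -/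
private def extendPair {β : Type*} [Zero β] (g : OddSet n → PMatch n → β) (U : Finset (Fin n))
    (M : Finset (Sym2 (Fin n))) : β :=
  if hU : Odd U.card then (if hM : IsPMOn univ M then g ⟨U, hU⟩ ⟨M, hM⟩ else 0) else 0

/-- The zero extension agrees with `g` on the subtypes. [folklore] -/
private theorem extendPair_apply {β : Type*} [Zero β] (g : OddSet n → PMatch n → β) (U : OddSet n) (M : PMatch n) :
    extendPair g U.1 M.1 = g U M := by
  unfold extendPair
  rw [dif_pos U.2, dif_pos M.2]

/-- **SUM TRANSPORT FOR PAIR FUNCTIONS, kernel currency.** For a perfect matching `S` of `V`, an even pattern `π ⊆ V`,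
families `X` of odd cuts and `Y` of perfect matchings of `K_n`, and any `g : OddSet n → PMatch n → β`:
`Σ_{U ∈ X, U ∩ V = π} Σ_{M ∈ Y, S ⊆ M} g U M = Σ_{Ũ ∈ X̃} Σ_{M̃ ∈ Ỹ} g (liftOdd Ũ) (liftPMatch M̃)`,
`X̃ = oddCellCuts X V π h`, `Ỹ = pmCellMatchings Y V S h`. [cite: Rothvoss2017, §2 (PDF p. 6)] [cite: KupavskiiZakharov2022, §2 (p. 6)] -/
theorem sum_cell_eq_sum_lift {β : Type*} [AddCommMonoid β] {V π : Finset (Fin n)} {S : Finset (Sym2 (Fin n))}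
    (hS : IsPMOn V S) (h : (univ \ V).card = m) (hπ : π ⊆ V) (hπe : Even π.card)
    (X : Finset (OddSet n)) (Y : Finset (PMatch n)) (g : OddSet n → PMatch n → β) :
    ∑ U ∈ X.filter (fun U => U.1 ∩ V = π), ∑ M ∈ Y.filter (fun M => S ⊆ M.1), g U M =
      ∑ Ut ∈ oddCellCuts X V π h, ∑ Mt ∈ pmCellMatchings Y V S h,
        g (liftOdd V π h hπ hπe Ut) (liftPMatch V S h hS Mt) := by
  have hY := image_val_subset Y
  -- pass to the underlying finsets with the zero extension of `g`
  have hL : ∑ U ∈ X.filter (fun U => U.1 ∩ V = π), ∑ M ∈ Y.filter (fun M => S ⊆ M.1), g U M =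
      ∑ U ∈ cutsWith (X.image Subtype.val) V π, ∑ M ∈ supersets (Y.image Subtype.val) S,
        extendPair g U M := by
    rw [cutsWith, filter_image, sum_image fun _ _ _ _ hxy => Subtype.val_injective hxy]
    refine sum_congr rfl fun U _ => ?_
    rw [supersets, filter_image, sum_image fun _ _ _ _ hxy => Subtype.val_injective hxy]
    exact sum_congr rfl fun M _ => (extendPair_apply g U M).symm
  have hR : ∑ Ut ∈ oddCellCuts X V π h, ∑ Mt ∈ pmCellMatchings Y V S h,
        g (liftOdd V π h hπ hπe Ut) (liftPMatch V S h hS Mt) =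
      ∑ Ut ∈ cellCuts (X.image Subtype.val) V π h, ∑ Mt ∈ cellMatchings (Y.image Subtype.val) V S h,
        extendPair g (Ut.image (emb V h) ∪ π) (S ∪ Mt.image (Sym2.map (emb V h))) := by
    calc ∑ Ut ∈ oddCellCuts X V π h, ∑ Mt ∈ pmCellMatchings Y V S h,
          g (liftOdd V π h hπ hπe Ut) (liftPMatch V S h hS Mt)
        = ∑ Ut ∈ oddCellCuts X V π h, ∑ Mt ∈ pmCellMatchings Y V S h,
            extendPair g (Ut.1.image (emb V h) ∪ π) (S ∪ Mt.1.image (Sym2.map (emb V h))) :=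
          -- the summands agree on the subtypes: unfold the extension at the lifted (odd, perfect) pair
          sum_congr rfl fun Ut _ => sum_congr rfl fun Mt _ =>
            (extendPair_apply g (liftOdd V π h hπ hπe Ut) (liftPMatch V S h hS Mt)).symm
      _ = ∑ Ut ∈ cellCuts (X.image Subtype.val) V π h, ∑ Mt ∈ pmCellMatchings Y V S h,
            extendPair g (Ut.image (emb V h) ∪ π) (S ∪ Mt.1.image (Sym2.map (emb V h))) := by
          rw [oddCellCuts]
          exact sum_subtype_of_mem (fun Ut : Finset (Fin m) => ∑ Mt ∈ pmCellMatchings Y V S h,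
            extendPair g (Ut.image (emb V h) ∪ π) (S ∪ Mt.1.image (Sym2.map (emb V h))))
            (fun Ut hUt => odd_of_mem_cellCuts hπe hUt)
      _ = _ := by
          refine sum_congr rfl fun Ut _ => ?_
          rw [pmCellMatchings]
          exact sum_subtype_of_mem (fun Mt : Finset (Sym2 (Fin m)) =>
            extendPair g (Ut.image (emb V h) ∪ π) (S ∪ Mt.image (Sym2.map (emb V h))))
            (fun Mt hMt => mem_perfectMatchings.1 (cellMatchings_subset hY hS h hMt))
  rw [hL, hR, sum_cell_eq_sum_pullback_pair hS h _ hY]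

end Kernel

/-! ## §3 Reduced strategies: psd rectangles restrict on non-crossing cells; the cell value -/

section Strategies

variable {r : ℕ}

/-- **Contraction conditions transport to the reduced strategy** (every cell): if `0 ⪯ X_U ⪯ I` and `0 ⪯ Y_M ⪯ I` for all
`U, M`, the same holds for `X ∘ liftOdd`, `Y ∘ liftPMatch`. [cite: BrietDadushPokutta2014, Thm. 6 (§3)] -/
theorem isContractionFamily_lift {V π : Finset (Fin n)} {S : Finset (Sym2 (Fin n))} (hS : IsPMOn V S)
    (h : (univ \ V).card = m) (hπ : π ⊆ V) (hπe : Even π.card)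
    {X : OddSet n → Matrix (Fin r) (Fin r) ℝ} {Y : PMatch n → Matrix (Fin r) (Fin r) ℝ}
    (hX : ∀ U, (X U).PosSemidef ∧ (1 - X U).PosSemidef) (hYc : ∀ M, (Y M).PosSemidef ∧ (1 - Y M).PosSemidef) :
    (∀ Ut, (X (liftOdd V π h hπ hπe Ut)).PosSemidef ∧ (1 - X (liftOdd V π h hπ hπe Ut)).PosSemidef) ∧
      ∀ Mt, (Y (liftPMatch V S h hS Mt)).PosSemidef ∧ (1 - Y (liftPMatch V S h hS Mt)).PosSemidef :=
  ⟨fun _ => hX _, fun _ => hYc _⟩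

/-- **Psd rectangles restrict to psd rectangles on NON-CROSSING cells.** If `(X, Y)` is a psd rectangle of dimension `r`
(`IsPsdRect`: contractions, `X_U Y_M = 0` whenever `cc(U,M) = 1`) and no core edge crosses the pattern (`crossCount π S = 0`),
then the reduced strategy `(X ∘ liftOdd, Y ∘ liftPMatch)` is a psd rectangle of dimension `r` of the reduced instance `K_m`:
a tight reduced pair lifts to a tight pair (`cc_lift`). For `r = 1` and `0/1` values this is "a tight-free rectangle restricts
to a tight-free rectangle". [cite: BrietDadushPokutta2014, Thm. 6 (§3)] [cite: Rothvoss2017, §2 (PDF p. 6)] -/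
theorem IsPsdRect.lift {V π : Finset (Fin n)} {S : Finset (Sym2 (Fin n))} (hS : IsPMOn V S)
    (h : (univ \ V).card = m) (hπ : π ⊆ V) (hπe : Even π.card) (hy : crossCount π S = 0)
    {X : OddSet n → Matrix (Fin r) (Fin r) ℝ} {Y : PMatch n → Matrix (Fin r) (Fin r) ℝ} (hXY : IsPsdRect X Y) :
    IsPsdRect (fun Ut => X (liftOdd V π h hπ hπe Ut)) (fun Mt => Y (liftPMatch V S h hS Mt)) := by
  refine ⟨fun Ut => hXY.1 _, fun Mt => hXY.2.1 _, fun Ut Mt hcc => hXY.2.2 _ _ ?_⟩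
  rw [cc_lift hS h hπ hπe, hcc, hy]

/-- In general (crossing cells included) the reduced strategy annihilates the reduced pairs at shifted level `1`:
`X̃_Ũ Ỹ_M̃ = 0` whenever `cc Ũ M̃ + y = 1`. [cite: BrietDadushPokutta2014, Thm. 6 (§3)] -/
theorem mul_lift_eq_zero_of_cc {V π : Finset (Fin n)} {S : Finset (Sym2 (Fin n))} (hS : IsPMOn V S)
    (h : (univ \ V).card = m) (hπ : π ⊆ V) (hπe : Even π.card)
    {X : OddSet n → Matrix (Fin r) (Fin r) ℝ} {Y : PMatch n → Matrix (Fin r) (Fin r) ℝ} (hXY : IsPsdRect X Y)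
    {Ut : OddSet m} {Mt : PMatch m} (hcc : cc Ut Mt + crossCount π S = 1) :
    X (liftOdd V π h hπ hπe Ut) * Y (liftPMatch V S h hS Mt) = 0 :=
  hXY.2.2 _ _ (by rw [cc_lift hS h hπ hπe, hcc])

/-- **The value of a cell, read on the reduced strategy.** For a planted weight `W = levelWeight n t C w`, a core `S`
(perfect matching of `V`), an even pattern `π ⊆ V`, families `A` of odd cuts and `B` of perfect matchings, and ANY pair of
matrix-valued functions `X, Y`:
`Σ_{U ∈ A, U ∩ V = π} Σ_{M ∈ B, S ⊆ M} W(U,M) · tr(X_U Y_M) = Σ_{Ũ ∈ Ã} Σ_{M̃ ∈ B̃} W''(Ũ, M̃) · tr(X̃_Ũ Ỹ_M̃)` with the SHIFTED level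
function `W''(Ũ, M̃) = levelFn n t C w (|Ũ| + |π|) (cc Ũ M̃ + y)` and the reduced strategy `X̃ = X ∘ liftOdd`, `Ỹ = Y ∘ liftPMatch`.
[cite: Rothvoss2017, §2 (PDF p. 6, eq. (2))] [cite: KupavskiiZakharov2022, §2 (p. 6)] -/
theorem cell_value_eq_lift {V π : Finset (Fin n)} {S : Finset (Sym2 (Fin n))} (hS : IsPMOn V S)
    (h : (univ \ V).card = m) (hπ : π ⊆ V) (hπe : Even π.card) (t : ℕ) (C : Finset ℕ) (w : ℕ → ℝ)
    (X : OddSet n → Matrix (Fin r) (Fin r) ℝ) (Y : PMatch n → Matrix (Fin r) (Fin r) ℝ)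
    (A : Finset (OddSet n)) (B : Finset (PMatch n)) :
    ∑ U ∈ A.filter (fun U => U.1 ∩ V = π), ∑ M ∈ B.filter (fun M => S ⊆ M.1),
        levelWeight n t C w U M * (X U * Y M).trace =
      ∑ Ut ∈ oddCellCuts A V π h, ∑ Mt ∈ pmCellMatchings B V S h,
        levelFn n t C w (Ut.1.card + π.card) (cc Ut Mt + crossCount π S) *
          (X (liftOdd V π h hπ hπe Ut) * Y (liftPMatch V S h hS Mt)).trace := by
  rw [sum_cell_eq_sum_lift hS h hπ hπe A B (fun U M => levelWeight n t C w U M * (X U * Y M).trace)]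
  refine sum_congr rfl fun Ut _ => sum_congr rfl fun Mt _ => ?_
  rw [levelWeight_eq_levelFn, card_liftOdd, cc_lift hS h hπ hπe]

/-- The same for a general pair function in place of the trace (e.g. the matrix product itself, or any bilinear pairing of the
two strategies). [cite: Rothvoss2017, §2 (PDF p. 6, eq. (2))] -/
theorem cell_sum_levelWeight_smul_eq_lift {β : Type*} [AddCommMonoid β] [Module ℝ β] {V π : Finset (Fin n)}
    {S : Finset (Sym2 (Fin n))} (hS : IsPMOn V S) (h : (univ \ V).card = m) (hπ : π ⊆ V) (hπe : Even π.card)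
    (t : ℕ) (C : Finset ℕ) (w : ℕ → ℝ) (G : OddSet n → PMatch n → β) (A : Finset (OddSet n)) (B : Finset (PMatch n)) :
    ∑ U ∈ A.filter (fun U => U.1 ∩ V = π), ∑ M ∈ B.filter (fun M => S ⊆ M.1), levelWeight n t C w U M • G U M =
      ∑ Ut ∈ oddCellCuts A V π h, ∑ Mt ∈ pmCellMatchings B V S h,
        levelFn n t C w (Ut.1.card + π.card) (cc Ut Mt + crossCount π S) •
          G (liftOdd V π h hπ hπe Ut) (liftPMatch V S h hS Mt) := by
  rw [sum_cell_eq_sum_lift hS h hπ hπe A B (fun U M => levelWeight n t C w U M • G U M)]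
  refine sum_congr rfl fun Ut _ => sum_congr rfl fun Mt _ => ?_
  rw [levelWeight_eq_levelFn, card_liftOdd, cc_lift hS h hπ hπe]

end Strategies

/-! ## §4 Weighted homogeneity transports to the reduced instance -/

section Weighted

/-- **Mass of the pulled-back family under the reduced weight.** For a family `𝒳` of perfect matchings of `K_n`, a core `S`
(perfect matching of `V`) and a weight `y` on edge sets, the reduced weight `M̃ ↦ y(S ∪ emb(M̃))` gives the pulled-back family
`cellMatchings 𝒳 V S h` the mass `y(𝒳(S))` of the star of `S` in `𝒳` (the pull-back is a bijection from the star onto the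
reduced family, with inverse the lift). [cite: KupavskiiZakharov2022, §2 (p. 6: the link; renaming the ground set)] -/
theorem wmass_cellMatchings {V : Finset (Fin n)} {S : Finset (Sym2 (Fin n))} (hS : IsPMOn V S)
    (h : (univ \ V).card = m) {𝒳 : Finset (Finset (Sym2 (Fin n)))} (h𝒳 : 𝒳 ⊆ perfectMatchings univ)
    (y : Finset (Sym2 (Fin n)) → ℝ) :
    wmass (fun Mt => y (S ∪ Mt.image (Sym2.map (emb V h)))) (cellMatchings 𝒳 V S h) = wmass y (supersets 𝒳 S) := by
  have hpm : ∀ M ∈ supersets 𝒳 S, IsPMOn univ M := fun M hM =>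
    mem_perfectMatchings.1 (h𝒳 (mem_supersets.1 hM).1)
  unfold wmass
  rw [cellMatchings, sum_image fun M₁ h₁ M₂ h₂ heq =>
    pmPullback_injOn h hS (hpm M₁ h₁) (hpm M₂ h₂) (mem_supersets.1 h₁).2 (mem_supersets.1 h₂).2 heq]
  refine sum_congr rfl fun M hM => ?_
  rw [image_pmPullback_eq_sdiff h hS (hpm M hM) (mem_supersets.1 hM).2, union_sdiff_of_subset (mem_supersets.1 hM).2]

/-- **Weighted homogeneity transports to the reduced instance.** If every member of a family `ℱ` of perfect matchings of
`K_n` contains the core `S` (a perfect matching of `V`) and the weight `y` carried by `ℱ` is `(PM_n(S), τ)`-homogeneous — e.g.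
a piece of the weighted Kupavskii–Zakharov approximation `exists_weightedSpreadApproximation` — then the reduced weight
`M̃ ↦ y(S ∪ emb(M̃))` carried by the pulled-back family `{emb⁻¹ M : M ∈ ℱ}` is `(PM_m, τ)`-homogeneous, `m = n − |V|`
(test a set `T̃` of reduced pairs through its image `emb(T̃)`; the whole star pulls back onto `PM_m`; masses by
`wmass_cellMatchings`). Set version: `isRelHomogeneous_cellMatchings`. [cite: KupavskiiZakharov2022, Lemma 11 (ii) (ℱ_i is (𝒜(S_i), τ)-homogeneous; renaming the ground set)] -/
theorem isRelHomogeneousW_cellMatchings {τ : ℝ} {V : Finset (Fin n)} {S : Finset (Sym2 (Fin n))} (hS : IsPMOn V S)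
    (h : (univ \ V).card = m) {ℱ : Finset (Finset (Sym2 (Fin n)))} (hℱ : ℱ ⊆ perfectMatchings univ)
    (hℱS : ∀ M ∈ ℱ, S ⊆ M) {y : Finset (Sym2 (Fin n)) → ℝ}
    (hhom : IsRelHomogeneousW τ (supersets (perfectMatchings univ) S) y ℱ) :
    IsRelHomogeneousW τ (perfectMatchings (univ : Finset (Fin m)))
      (fun Mt => y (S ∪ Mt.image (Sym2.map (emb V h)))) (cellMatchings ℱ V S h) := by
  intro Tt
  set T : Finset (Sym2 (Fin n)) := Tt.image (Sym2.map (emb V h)) with hTdef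
  have hT : T.card = Tt.card := card_image_of_injective _ (Sym2.map.injective (emb_injective V h))
  have hPM : supersets (perfectMatchings (univ : Finset (Fin n))) T ⊆ perfectMatchings univ := supersets_subset _ _
  rw [← cellMatchings_perfectMatchings hS h, supersets_cellMatchings, supersets_cellMatchings,
    wmass_cellMatchings hS h ((supersets_subset _ _).trans hℱ) y, wmass_cellMatchings hS h hℱ y,
    card_cellMatchings hPM hS h, card_cellMatchings Subset.rfl hS h, ← hT, supersets_supersets,
    supersets_supersets, union_comm T S, ← supersets_supersets, ← supersets_supersets,
    supersets_eq_self_of_forall hℱS]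
  exact hhom T

/-- The core of a weighted Kupavskii–Zakharov piece of a family of perfect matchings is a partial matching: a perfect matching
of its support `verts S_i`. [cite: KupavskiiZakharov2022, Lemma 11 (the cores `S_i` are subsets of members)] -/
theorem isPMOn_verts_coreW {ℱ : Finset (Finset (Sym2 (Fin n)))} (hℱ : ℱ ⊆ perfectMatchings univ)
    {y : Finset (Sym2 (Fin n)) → ℝ} {τ : ℝ} {q : ℕ}
    (D : WeightedSpreadApproximation (perfectMatchings univ) ℱ y τ q) (i : Fin D.k) :
    IsPMOn (verts (D.core i)) (D.core i) := by
  obtain ⟨M, hM⟩ := D.piece_nonempty i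
  exact isPMOn_verts (mem_perfectMatchings.1 (hℱ (D.piece_subset_family i hM))) (D.core_subset_of_mem_piece hM)

/-- **The pieces of the weighted spread approximation, reduced.** For the `i`-th piece of a weighted Kupavskii–Zakharov
approximation of `(ℱ ⊆ PM_n, y)` (core `S_i`, support `V_i = verts S_i`, `m = n − |V_i|`): the reduced weight
`M̃ ↦ y(S_i ∪ emb(M̃))` carried by the pull-back of `ℱ_i` is `(PM_m, τ)`-homogeneous; the pull-back consists of perfect
matchings of `K_m`; its reduced mass is `y(ℱ_i)`; and it has `|ℱ_i|` members. Set version: `isRelHomogeneous_cellMatchings_piece`.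
[cite: KupavskiiZakharov2022, Lemma 11 (ii)] -/
theorem isRelHomogeneousW_cellMatchings_piece {ℱ : Finset (Finset (Sym2 (Fin n)))} (hℱ : ℱ ⊆ perfectMatchings univ)
    {y : Finset (Sym2 (Fin n)) → ℝ} {τ : ℝ} {q : ℕ}
    (D : WeightedSpreadApproximation (perfectMatchings univ) ℱ y τ q) (i : Fin D.k)
    (h : (univ \ verts (D.core i)).card = m) :
    IsRelHomogeneousW τ (perfectMatchings (univ : Finset (Fin m)))
        (fun Mt => y (D.core i ∪ Mt.image (Sym2.map (emb (verts (D.core i)) h))))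
        (cellMatchings (D.piece i) (verts (D.core i)) (D.core i) h) ∧
      cellMatchings (D.piece i) (verts (D.core i)) (D.core i) h ⊆ perfectMatchings univ ∧
      wmass (fun Mt => y (D.core i ∪ Mt.image (Sym2.map (emb (verts (D.core i)) h))))
          (cellMatchings (D.piece i) (verts (D.core i)) (D.core i) h) = wmass y (D.piece i) ∧
      (cellMatchings (D.piece i) (verts (D.core i)) (D.core i) h).card = (D.piece i).card := by
  have hS := isPMOn_verts_coreW hℱ D i
  have hPℱ : D.piece i ⊆ perfectMatchings univ := (D.piece_subset_family i).trans hℱ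
  have hPS : ∀ M ∈ D.piece i, D.core i ⊆ M := fun M hM => D.core_subset_of_mem_piece hM
  refine ⟨isRelHomogeneousW_cellMatchings hS h hPℱ hPS (D.homogeneous i), cellMatchings_subset hPℱ hS h, ?_, ?_⟩
  · rw [wmass_cellMatchings hS h hPℱ y, supersets_eq_self_of_forall hPS]
  · rw [card_cellMatchings hPℱ hS h, supersets_eq_self_of_forall hPS]

/-- **The reduced piece in `PMatch` currency.** For a family `Y : Finset (PMatch n)`, a weighted Kupavskii–Zakharov
approximation `D` of its edge-set family `{M.1 : M ∈ Y}` with weight `y`, and its `i`-th piece: the family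
`Ỹ_i = pmCellMatchings (Y.filter (·.1 ∈ ℱ_i)) V_i S_i h : Finset (PMatch m)` has edge sets forming a `(PM_m, τ)`-homogeneous
carrier of the reduced weight, of reduced mass `y(ℱ_i)`, with `|ℱ_i|` members. Set version: `isRelHomogeneous_pmCellMatchings_piece`.
[cite: KupavskiiZakharov2022, Lemma 11 (ii)] -/
theorem isRelHomogeneousW_pmCellMatchings_piece (Y : Finset (PMatch n)) {y : Finset (Sym2 (Fin n)) → ℝ} {τ : ℝ} {q : ℕ}
    (D : WeightedSpreadApproximation (perfectMatchings univ) (Y.image Subtype.val) y τ q) (i : Fin D.k)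
    (h : (univ \ verts (D.core i)).card = m) :
    IsRelHomogeneousW τ (perfectMatchings (univ : Finset (Fin m)))
        (fun Mt => y (D.core i ∪ Mt.image (Sym2.map (emb (verts (D.core i)) h))))
        ((pmCellMatchings (Y.filter fun M => M.1 ∈ D.piece i) (verts (D.core i)) (D.core i) h).image Subtype.val) ∧
      wmass (fun Mt => y (D.core i ∪ Mt.image (Sym2.map (emb (verts (D.core i)) h))))
          ((pmCellMatchings (Y.filter fun M => M.1 ∈ D.piece i) (verts (D.core i)) (D.core i) h).image Subtype.val) =
        wmass y (D.piece i) ∧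
      (pmCellMatchings (Y.filter fun M => M.1 ∈ D.piece i) (verts (D.core i)) (D.core i) h).card = (D.piece i).card := by
  have hS := isPMOn_verts_coreW (image_val_subset Y) D i
  have hP : D.piece i ⊆ Y.image Subtype.val := D.piece_subset_family i
  obtain ⟨hhom, -, hw, hcard⟩ := isRelHomogeneousW_cellMatchings_piece (image_val_subset Y) D i h
  rw [image_val_pmCellMatchings _ hS h, image_val_filter_mem_eq Y hP]
  refine ⟨hhom, hw, ?_⟩
  calc (pmCellMatchings (Y.filter fun M => M.1 ∈ D.piece i) (verts (D.core i)) (D.core i) h).card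
      = ((pmCellMatchings (Y.filter fun M => M.1 ∈ D.piece i) (verts (D.core i)) (D.core i) h).image Subtype.val).card :=
        (card_image_of_injective _ Subtype.val_injective).symm
    _ = (D.piece i).card := by rw [image_val_pmCellMatchings _ hS h, image_val_filter_mem_eq Y hP, hcard]

/-- **A weight coming from the perfect matchings of `K_n`, reduced, is that weight at the lift.** For `yP : PMatch n → ℝ`
(e.g. the trace density `M ↦ tr(Y_M)/r` of a psd strategy) extended by `0` to all edge sets, the reduced weight at a perfect
matching `M̃` of `K_m` is `yP (liftPMatch M̃)` — so the reduced weight of §4 is the trace density of the reduced strategy of §3.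
[cite: KupavskiiZakharov2022, §2 (p. 6)] -/
theorem dite_weight_lift {V : Finset (Fin n)} {S : Finset (Sym2 (Fin n))} (hS : IsPMOn V S) (h : (univ \ V).card = m)
    (yP : PMatch n → ℝ) (Mt : PMatch m) :
    (fun M : Finset (Sym2 (Fin n)) => if hM : IsPMOn univ M then yP ⟨M, hM⟩ else 0)
        (S ∪ Mt.1.image (Sym2.map (emb V h))) = yP (liftPMatch V S h hS Mt) := by
  simp only [liftPMatch]
  rw [dif_pos (isPMOn_lift hS h Mt.2)]

/-- The mass of a family `Y : Finset (PMatch n)` under the zero-extended weight is `Σ_{M ∈ Y} yP M`.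
[cite: KupavskiiZakharov2022, §2 (p. 6)] -/
theorem wmass_image_val_dite (yP : PMatch n → ℝ) (Y : Finset (PMatch n)) :
    wmass (fun M : Finset (Sym2 (Fin n)) => if hM : IsPMOn univ M then yP ⟨M, hM⟩ else 0) (Y.image Subtype.val) =
      ∑ M ∈ Y, yP M := by
  unfold wmass
  rw [sum_image fun _ _ _ _ hxy => Subtype.val_injective hxy]
  refine sum_congr rfl fun M _ => ?_
  rw [dif_pos M.2]

end Weighted

end Literature.Combinatorics.AssociationSchemes.CutMatchingRestrictionStrategies
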